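import Literature.Geometry.Riemannian.GaussBonnetLocal
import Literature.Geometry.Riemannian.GaussBonnetGradient
import Literature.Geometry.Lorentzian.HessianLocalMax
import Literature.Topology.FourManifolds.MorseProofs
import Mathlib.MeasureTheory.Measure.Lebesgue.EqHaar
import Mathlib.Analysis.Calculus.FDeriv.Symmetric
import HarnessLib

/-!
# The volume of small sublevel sets at a nondegenerate minimum: the density of the Riemannian measure

Let `(N, h)` be a Riemannian `m`-manifold (modelled on `ℝᵐ`) and `u ∈ C²(N)` with `u(y₀) = 0`,
`du(y₀) = 0` and `Hess_h u(y₀) = h_{y₀}`. We PROVE (`le_measure_setOf_lt_of_hessian_eq`): for every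
`ε > 0` there is `s₀ > 0` such that

  `μ_h {u < s} ≥ (1 − ε) ω_m (2s)^{m/2}`   for `0 < s < s₀`,   `ω_m = vol B^m(0, 1)`.

Examples: `u = d(y₀, ·)²/2` (small geodesic balls have almost Euclidean volume), and — the case this
file is written for — `u = φ ∘ f` for an isometric immersion `f : N → M` and an ambient `φ` with
`φ(f y₀) = 0`, `dφ(f y₀) = 0`, `Hess φ(f y₀) = g` (e.g. `φ = |x − f(y₀)|²/2` in `ℝⁿ`), for which
`Hess_{f^*g}(φ ∘ f)(y₀) = (f^*g)_{y₀}`: together with the monotonicity formula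
(`MonotonicityFormula.lean`, `MinimalSurfaceMonotonicity.lean`) it yields the absolute area bound
`Area(Σ ∩ B_r(x₀)) ≥ ω_k r^k` for minimal hypersurfaces through `x₀`
(`MinimalSurfaceAreaLowerBound.lean`; Morgan 2016, Cor. 9.5; Schoen–Yau 1979, (2.23)). It is the
elementary half — density `≥ 1` at every point of a `C²` submanifold — of the density theory of
geometric measure theory (Morgan 2016, §9.2: `Θ^m(T, a) = lim_{r→0} M(T ∩ B(a, r))/α_m r^m`).

Proof, in the chart `φ` at `y₀` (`c = φ y₀`): write `h_{y₀}(v, w) = ⟨Av, Aw⟩` with `A` invertible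
(`exists_continuousLinearEquiv_of_norm_eq_norm_symmL`); the chart representative `û` has
`Dû(c) = 0` and `D²û(c)(v, v) = Hess u(v, v) = ‖Av‖²`
(`hessian_eq_fderiv_fderiv_of_fderiv_eq_zero`), so by the second-order Taylor estimate
(`abs_sub_sub_half_fderiv_fderiv_le`, mean value inequality) `û(c + x) ≤ (1+η)‖Ax‖²/2` for small
`x`, which puts the ellipsoid `{‖Ax‖² < 2s(1−η)}` (Lebesgue measure `|det A|⁻¹ (2s(1−η))^{m/2} ω_m`,
`volume_preimage_ball_eq`) inside the chart image of `{u < s}`; the Riemannian density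
`√det(h_{ij})` equals `|det A|` at `c` (`sqrt_det_gram_eq_abs_det`) and is `≥ (1−η)|det A|` nearby
(`map_extChartAt_restrict_riemannianMeasure`); finally `(1−η)^{1+m/2} ≥ 1 − ε` for
`η = min(ε, ½)/(m+1)`.

Everything is proved; no definitions, no named facts.

## References

* F. Morgan, *Geometric Measure Theory. A Beginner's Guide*, 5th ed., Academic Press 2016, §9.2
  (densities and mass ratios), Cor. 9.5. [Morgan2016]
* R. Schoen, S.-T. Yau, Comm. Math. Phys. 65 (1979) 45–76, §2, p. 56, (2.23). [SchoenYauPMT1979]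
-/

noncomputable section

open Bundle Set Function Filter Module MeasureTheory Metric
open scoped Manifold ContDiff Topology RealInnerProductSpace ENNReal

namespace Literature.Geometry.Riemannian

open Literature.Geometry.Lorentzian Literature.Geometry.Lorentzian.PseudoRiemannianMetric
open Literature.Topology.FourManifolds

/-! ### Calculus: second-order Taylor estimate at a critical point -/

section Taylor

variable {E : Type*} [NormedAddCommGroup E] [NormedSpace ℝ E]

/-- **Second-order Taylor estimate at a critical point**: if `f` is `C²` at `c` with
`Df(c) = 0`, then for every `ε > 0` there is `δ > 0` with
`|f(c + x) − f(c) − ½ D²f(c)(x, x)| ≤ ε ‖x‖²` for `‖x‖ < δ` (mean value inequality applied to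
`x ↦ f(c+x) − ½ D²f(c)(x,x)`, whose derivative at `x` is `Df(c+x) − D²f(c)(x, ·) = o(‖x‖)` by the
differentiability of `Df` at `c` and the symmetry of `D²f(c)`). [folklore] -/
theorem abs_sub_sub_half_fderiv_fderiv_le {f : E → ℝ} {c : E} (hf : ContDiffAt ℝ 2 f c)
    (hc : fderiv ℝ f c = 0) {ε : ℝ} (hε : 0 < ε) :
    ∃ δ : ℝ, 0 < δ ∧ ∀ x : E, ‖x‖ < δ →
      |f (c + x) - f c - (1 / 2) * fderiv ℝ (fderiv ℝ f) c x x| ≤ ε * ‖x‖ ^ 2 := by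
  set B := fderiv ℝ (fderiv ℝ f) c with hB
  -- `Df` is differentiable at `c` with derivative `B`, and `D²f(c)` is symmetric
  have hD : HasFDerivAt (fderiv ℝ f) B c :=
    ((hf.fderiv_right (m := 1) le_rfl).differentiableAt one_ne_zero).hasFDerivAt
  have hsymm : ∀ v w, B v w = B w v := fun v w ↦
    hf.isSymmSndFDerivAt (by simp) v w
  -- `f` is differentiable near `c`
  have hdiff : ∀ᶠ y in 𝓝 c, DifferentiableAt ℝ f y :=
    (hf.eventually (by simp)).mono fun y hy ↦ hy.differentiableAt (by simp)
  -- little-o: `‖Df(c + x) − B x‖ ≤ ε ‖x‖` for small `x`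
  have hlo := hD.isLittleO
  rw [Asymptotics.isLittleO_iff] at hlo
  have h1 : ∀ᶠ y in 𝓝 c, ‖fderiv ℝ f y - fderiv ℝ f c - B (y - c)‖ ≤ ε * ‖y - c‖ := hlo hε
  obtain ⟨δ, hδ, hball⟩ := Metric.eventually_nhds_iff_ball.1 (h1.and hdiff)
  refine ⟨δ, hδ, fun x hx ↦ ?_⟩
  -- the auxiliary function `w(z) = f(c + z) − ½ B z z`
  set w : E → ℝ := fun z ↦ f (c + z) - (1 / 2) * B z z with hw
  have hquad : ∀ z, HasFDerivAt (fun z : E ↦ B z z) (B z + (B.flip) z) z := by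
    intro z
    have hb : IsBoundedBilinearMap ℝ (fun p : E × E ↦ B p.1 p.2) := B.isBoundedBilinearMap
    have h1 : HasFDerivAt (fun y : E ↦ (y, y))
        ((ContinuousLinearMap.id ℝ E).prod (ContinuousLinearMap.id ℝ E)) z :=
      (hasFDerivAt_id z).prodMk (hasFDerivAt_id z)
    have h2 := HasFDerivAt.comp z (g := fun p : E × E ↦ B p.1 p.2) (f := fun y : E ↦ (y, y))
      (hb.hasFDerivAt (z, z)) h1
    have hfun : (fun p : E × E ↦ B p.1 p.2) ∘ (fun y : E ↦ (y, y)) = fun y ↦ B y y := rfl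
    rw [hfun] at h2
    refine h2.congr_fderiv ?_
    ext v
    simp [IsBoundedBilinearMap.deriv_apply]
  have hwd : ∀ z ∈ ball (0 : E) δ, HasFDerivAt w
      ((fderiv ℝ f (c + z)).comp (ContinuousLinearMap.id ℝ E) - (1 / 2 : ℝ) • (B z + B.flip z)) z := by
    intro z hz
    have hz' : c + z ∈ ball c δ := by simpa [dist_eq_norm] using hz
    have hfz : HasFDerivAt (fun z ↦ f (c + z)) ((fderiv ℝ f (c + z)).comp (ContinuousLinearMap.id ℝ E)) z :=
      ((hball _ hz').2.hasFDerivAt).comp z ((hasFDerivAt_id z).const_add c)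
    exact hfz.sub ((hquad z).const_mul (1 / 2))
  -- bound on `Dw` on the closed ball of radius `‖x‖`
  have hbound : ∀ z ∈ closedBall (0 : E) ‖x‖,
      ‖(fderiv ℝ f (c + z)).comp (ContinuousLinearMap.id ℝ E) - (1 / 2 : ℝ) • (B z + B.flip z)‖ ≤
        ε * ‖x‖ := by
    intro z hz
    have hzx : ‖z‖ ≤ ‖x‖ := by simpa using hz
    have hzδ : c + z ∈ ball c δ := by
      simp only [Metric.mem_ball, dist_eq_norm, add_sub_cancel_left]; exact hzx.trans_lt hx
    have hkey := (hball _ hzδ).1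
    rw [hc, sub_zero, add_sub_cancel_left] at hkey
    have hBz : (1 / 2 : ℝ) • (B z + B.flip z) = B z := by
      ext v
      simp only [FunLike.coe_smul, FunLike.coe_add, Pi.smul_apply,
        Pi.add_apply, ContinuousLinearMap.flip_apply, smul_eq_mul, hsymm v z]
      ring
    rw [hBz]
    have : (fderiv ℝ f (c + z)).comp (ContinuousLinearMap.id ℝ E) = fderiv ℝ f (c + z) := by
      ext v; simp
    rw [this]
    exact hkey.trans (mul_le_mul_of_nonneg_left hzx hε.le)
  have hsub : closedBall (0 : E) ‖x‖ ⊆ ball 0 δ := closedBall_subset_ball hx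
  have hmvt := (convex_closedBall (0 : E) ‖x‖).norm_image_sub_le_of_norm_hasFDerivWithin_le
    (fun z hz ↦ (hwd z (hsub hz)).hasFDerivWithinAt) hbound
    (mem_closedBall_self (norm_nonneg x)) (show x ∈ closedBall (0 : E) ‖x‖ from
      mem_closedBall.2 (by simp))
  have hw0 : w 0 = f c := by simp [hw]
  have hwx : w x - w 0 = f (c + x) - f c - (1 / 2) * B x x := by
    rw [hw0]; simp only [hw]; ring
  rw [← hwx, ← Real.norm_eq_abs]
  calc ‖w x - w 0‖ ≤ ε * ‖x‖ * ‖x - 0‖ := hmvt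
    _ = ε * ‖x‖ ^ 2 := by rw [sub_zero]; ring

end Taylor

/-! ### Lebesgue measure of ellipsoids -/

section Ellipsoid

variable {m : ℕ}

/-- The Lebesgue measure of the ellipsoid `{x | ‖A x‖ < t} = A⁻¹(B(0, t))` is
`|det A|⁻¹ tᵐ · vol B(0, 1)`. [folklore] -/
theorem volume_preimage_ball_eq (A : EuclideanSpace ℝ (Fin m) ≃L[ℝ] EuclideanSpace ℝ (Fin m))
    {t : ℝ} (ht : 0 < t) :
    volume ((A : EuclideanSpace ℝ (Fin m) → EuclideanSpace ℝ (Fin m)) ⁻¹' ball 0 t) =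
      ENNReal.ofReal (|LinearMap.det (A : EuclideanSpace ℝ (Fin m) →ₗ[ℝ] EuclideanSpace ℝ (Fin m))|⁻¹
        * t ^ m) * volume (ball (0 : EuclideanSpace ℝ (Fin m)) 1) := by
  rw [MeasureTheory.Measure.addHaar_preimage_continuousLinearEquiv, MeasureTheory.Measure.addHaar_ball_of_pos _ _ ht,
    finrank_euclideanSpace_fin, ← mul_assoc, ← ENNReal.ofReal_mul (abs_nonneg _)]
  congr 2
  have hcomp : (A.symm : EuclideanSpace ℝ (Fin m) →ₗ[ℝ] EuclideanSpace ℝ (Fin m)).comp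
      (A : EuclideanSpace ℝ (Fin m) →ₗ[ℝ] EuclideanSpace ℝ (Fin m)) = LinearMap.id := by
    ext x
    simp
  have hdet : LinearMap.det (A.symm : EuclideanSpace ℝ (Fin m) →ₗ[ℝ] EuclideanSpace ℝ (Fin m)) *
      LinearMap.det (A : EuclideanSpace ℝ (Fin m) →ₗ[ℝ] EuclideanSpace ℝ (Fin m)) = 1 := by
    rw [← LinearMap.det_comp, hcomp, LinearMap.det_id]
  have hne : LinearMap.det (A : EuclideanSpace ℝ (Fin m) →ₗ[ℝ] EuclideanSpace ℝ (Fin m)) ≠ 0 :=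
    (LinearEquiv.isUnit_det' A.toLinearEquiv).ne_zero
  rw [eq_inv_of_mul_eq_one_left hdet, abs_inv]

/-- Lebesgue measure is invariant under the translation `x ↦ c + x`. [folklore] -/
theorem volume_image_const_add (c : EuclideanSpace ℝ (Fin m)) (T : Set (EuclideanSpace ℝ (Fin m))) :
    volume ((fun x ↦ c + x) '' T) = volume T := by
  have : (fun x ↦ c + x) '' T = (fun e ↦ e + (-c)) ⁻¹' T := by
    ext e
    simp only [mem_image, mem_preimage]
    constructor
    · rintro ⟨x, hx, rfl⟩; simpa [add_comm] using hx
    · intro he; exact ⟨e + -c, he, by abel⟩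
  rw [this, measure_preimage_add_right]

end Ellipsoid

/-! ### The volume of small sublevel sets at a nondegenerate minimum -/

section Main

variable {m : ℕ} {N : Type*} [TopologicalSpace N] [ChartedSpace (EuclideanSpace ℝ (Fin m)) N]
  [IsManifold (𝓡 m) ∞ N] [T3Space N] [MeasurableSpace N] [BorelSpace N]
  (h : ContMDiffRiemannianMetric (𝓡 m) ∞ (EuclideanSpace ℝ (Fin m)) (TangentSpace (𝓡 m) : N → Type _))
  [(ofRiemannian h).HasLeviCivita]

set_option backward.isDefEq.respectTransparency false in
set_option maxHeartbeats 1600000 in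
/-- **Small sublevel sets at a nondegenerate minimum with Hessian equal to the metric have almost
Euclidean volume.** Let `(N, h)` be a Riemannian `m`-manifold and `u ∈ C²(N)` with `u(y₀) = 0`,
`du(y₀) = 0` and `Hess_h u (y₀) = h_{y₀}` (e.g. `u = d(y₀, ·)²/2`, or `u = |F − F(y₀)|²/2` on an
immersed submanifold of `ℝⁿ` with the induced metric). Then for every `ε > 0` there is `s₀ > 0`
with

  `μ_h {u < s} ≥ (1 − ε) ω_m (2s)^{m/2}`   for `0 < s < s₀`,

`ω_m = vol B(0,1)`. Proof in the chart at `y₀`: with `h_{y₀}(v, w) = ⟨Av, Aw⟩`, the second-order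
Taylor estimate (`abs_sub_sub_half_fderiv_fderiv_le`, `Hess = D²` at a critical point) puts the
ellipsoid `{‖Ax‖² < 2s(1−η)}` inside the chart image of `{u < s}`, and the Riemannian density
`√det(h_{ij})` is `≥ (1−η)|det A|` near the centre, where it equals `|det A|`
(`map_extChartAt_restrict_riemannianMeasure`). This is the elementary half ("density `≥ 1` at every
point of a smooth submanifold") of the density statements of geometric measure theory
(Morgan 2016, §9.2: `Θ^m(T, a) = lim_r M(T ∩ B(a,r))/α_m r^m`; Cor. 9.5). [cite: Morgan2016, §9.2 and Cor. 9.5] -/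
theorem le_measure_setOf_lt_of_hessian_eq {u : N → ℝ} (hu : ContMDiff (𝓡 m) 𝓘(ℝ, ℝ) 2 u) {y₀ : N}
    (hu0 : u y₀ = 0) (hcrit : IsMCriticalPt (𝓡 m) u y₀)
    (hHess : ∀ v w : TangentSpace (𝓡 m) y₀,
      (ofRiemannian h).hessian u y₀ v w = (ofRiemannian h).val y₀ v w)
    {ε : ℝ} (hε : 0 < ε) :
    ∃ s₀ : ℝ, 0 < s₀ ∧ ∀ s, 0 < s → s < s₀ →
      ENNReal.ofReal ((1 - ε) * Real.sqrt (2 * s) ^ m) *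
          volume (ball (0 : EuclideanSpace ℝ (Fin m)) 1) ≤
        riemannianMeasure h {y | u y < s} := by
  classical
  letI : RiemannianBundle (fun x : N ↦ TangentSpace (𝓡 m) x) :=
    ⟨h.toContinuousRiemannianMetric.toRiemannianMetric⟩
  -- notation
  set g := ofRiemannian h with hg
  set φ := extChartAt (𝓡 m) y₀ with hφ
  set c : EuclideanSpace ℝ (Fin m) := φ y₀ with hc
  set μ := riemannianMeasure h with hμ
  have hy₀s : y₀ ∈ (chartAt (EuclideanSpace ℝ (Fin m)) y₀).source := mem_chart_source (EuclideanSpace ℝ (Fin m)) y₀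
  have hct : c ∈ φ.target := mem_extChartAt_target y₀
  have hpc : φ.symm c = y₀ := extChartAt_to_inv y₀
  -- ### (1) the metric at `y₀` in the chart: `h_{y₀}(v, w) = ⟨A v, A w⟩`
  obtain ⟨A₀, hA₀⟩ := exists_norm_eq_norm_symmL (I := 𝓡 m) y₀ y₀
  obtain ⟨A, hA⟩ :=
    exists_continuousLinearEquiv_of_norm_eq_norm_symmL y₀ y₀ hy₀s hA₀
  have hA' : ∀ v w, metricRep (𝓡 m) g y₀ c v w = ⟪A v, A w⟫ := by
    intro v w
    rw [hA v, hA w, inner_eq_inner_symmL_of_norm_eq y₀ y₀ hA₀ v w, metricRep_apply_eq_val_symmL,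
      extChartAt_to_inv (I := 𝓡 m) y₀]
    rfl
  have hsymmL : ∀ v : EuclideanSpace ℝ (Fin m),
      (trivializationAt (EuclideanSpace ℝ (Fin m)) (TangentSpace (𝓡 m)) y₀).symmL ℝ y₀ v = v := by
    intro v
    rw [TangentBundle.symmL_trivializationAt_eq_core hy₀s]
    exact (tangentBundleCore (𝓡 m) N).coordChange_self (achart (EuclideanSpace ℝ (Fin m)) y₀) y₀ (by simp) v
  have hAval : ∀ v w : TangentSpace (𝓡 m) y₀, g.val y₀ v w = ⟪A v, A w⟫ := by
    intro v w
    rw [← hA' v w, metricRep_apply_eq_val_symmL, extChartAt_to_inv (I := 𝓡 m) y₀, hsymmL, hsymmL]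
  set dA : ℝ := LinearMap.det (A : EuclideanSpace ℝ (Fin m) →ₗ[ℝ] EuclideanSpace ℝ (Fin m)) with hdA
  have hdA0 : dA ≠ 0 := (LinearEquiv.isUnit_det' A.toLinearEquiv).ne_zero
  have hdApos : 0 < |dA| := abs_pos.2 hdA0
  set nT : ℝ := ‖(A.symm : EuclideanSpace ℝ (Fin m) →L[ℝ] EuclideanSpace ℝ (Fin m))‖ with hnT
  have hnT0 : 0 ≤ nT := norm_nonneg _
  have hxA : ∀ x, ‖x‖ ≤ nT * ‖A x‖ := fun x ↦ by
    calc ‖x‖ = ‖(A.symm : EuclideanSpace ℝ (Fin m) →L[ℝ] EuclideanSpace ℝ (Fin m)) (A x)‖ := by simp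
      _ ≤ nT * ‖A x‖ := (A.symm : EuclideanSpace ℝ (Fin m) →L[ℝ] EuclideanSpace ℝ (Fin m)).le_opNorm _
  -- ### (2) the density `ρ = √det(h_{ij})`: `ρ c = |det A|`, continuity near `c`
  set ρ : EuclideanSpace ℝ (Fin m) → ℝ := fun e ↦ Real.sqrt (chartGramMatrix h y₀ e).det with hρ
  have hρs : ContDiffOn ℝ ∞ ρ φ.target := contDiffOn_sqrt_det_chartGramMatrix h y₀
  have hρc_eq : ρ c = |dA| := by
    have hq : φ.symm c ∈ (chartAt (EuclideanSpace ℝ (Fin m)) y₀).source := by rw [hpc]; exact hy₀s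
    have hgram : ∀ i j, chartGramMatrix h y₀ c i j =
        ⟪A (EuclideanSpace.basisFun (Fin m) ℝ i), A (EuclideanSpace.basisFun (Fin m) ℝ j)⟫ := by
      intro i j
      rw [← hA', metricRep_apply_eq_val_symmL, hg, val_ofRiemannian,
        TangentBundle.symmL_trivializationAt hq, φ.right_inv hct]
      simp only [chartGramMatrix, Matrix.of_apply, EuclideanSpace.basisFun_apply]
      rfl
    have hmat : chartGramMatrix h y₀ c = Matrix.of fun i j ↦
        ⟪(A : EuclideanSpace ℝ (Fin m) →ₗ[ℝ] EuclideanSpace ℝ (Fin m))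
          (EuclideanSpace.basisFun (Fin m) ℝ i),
          (A : EuclideanSpace ℝ (Fin m) →ₗ[ℝ] EuclideanSpace ℝ (Fin m))
          (EuclideanSpace.basisFun (Fin m) ℝ j)⟫ := by
      ext i j
      rw [hgram i j, Matrix.of_apply]
      rfl
    rw [hρ, hdA]
    dsimp only
    rw [hmat, sqrt_det_gram_eq_abs_det]
  -- ### (3) the parameters
  set η : ℝ := min ε (1 / 2) / (m + 1) with hη
  have hm1 : (0 : ℝ) < m + 1 := by positivity
  have hη0 : 0 < η := by positivity
  have hηle : η ≤ 1 / 2 := by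
    rw [hη, div_le_iff₀ hm1]
    have : min ε (1 / 2) ≤ 1 / 2 := min_le_right _ _
    nlinarith [(m.cast_nonneg : (0 : ℝ) ≤ m)]
  have hη1 : η < 1 := by linarith
  have hBern : 1 - ε ≤ (1 - η) ^ (m + 1) := by
    have h1 : 1 + ((m + 1 : ℕ) : ℝ) * (-η) ≤ (1 + -η) ^ (m + 1) :=
      one_add_mul_le_pow (by linarith) (m + 1)
    have h2 : ((m + 1 : ℕ) : ℝ) * η = min ε (1 / 2) := by
      rw [hη]; push_cast; field_simp
    have h3 : min ε (1 / 2) ≤ ε := min_le_left _ _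
    calc 1 - ε ≤ 1 - min ε (1 / 2) := by linarith
      _ = 1 + ((m + 1 : ℕ) : ℝ) * (-η) := by rw [mul_neg, h2]; ring
      _ ≤ (1 + -η) ^ (m + 1) := h1
      _ = (1 - η) ^ (m + 1) := by ring
  -- density bound near `c`
  obtain ⟨δ₂, hδ₂, hδ₂t, hρge⟩ : ∃ δ₂ : ℝ, 0 < δ₂ ∧ ball c δ₂ ⊆ φ.target ∧
      ∀ e ∈ ball c δ₂, (1 - η) * |dA| ≤ ρ e := by
    have hcont : ContinuousAt ρ c :=
      (hρs.continuousOn.continuousWithinAt hct).continuousAt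
        ((isOpen_extChartAt_target y₀).mem_nhds hct)
    have hlt : (1 - η) * |dA| < ρ c := by
      rw [hρc_eq]; nlinarith
    have hev : ∀ᶠ e in 𝓝 c, (1 - η) * |dA| < ρ e := hcont.eventually (lt_mem_nhds hlt)
    obtain ⟨δ, hδ, hballδ⟩ := Metric.eventually_nhds_iff_ball.1
      (hev.and (eventually_mem_set.2 ((isOpen_extChartAt_target y₀).mem_nhds hct)))
    exact ⟨δ, hδ, fun e he ↦ (hballδ e he).2, fun e he ↦ (hballδ e he).1.le⟩
  -- ### (4) the chart representative and its Taylor expansion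
  set uh : EuclideanSpace ℝ (Fin m) → ℝ := writtenInExtChartAt (𝓡 m) 𝓘(ℝ, ℝ) y₀ u with huh
  have huh_apply : ∀ z, uh z = u (φ.symm z) := fun z ↦ writtenInExtChartAt_real_apply u y₀ z
  have hrange : range (𝓡 m) = univ := ModelWithCorners.Boundaryless.range_eq_univ
  have huh2 : ContDiffAt ℝ 2 uh c := by
    have h1 := (contMDiffAt_iff.1 (hu y₀)).2
    rw [hrange] at h1
    exact h1.contDiffAt univ_mem
  have hcrit' : fderiv ℝ uh c = 0 := by
    have h1 := (isMCriticalPt_iff_fderivWithin_writtenInExtChartAt_eq_zero (I := 𝓡 m)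
      (mem_extChartAt_source y₀) ((hu y₀).mdifferentiableAt (by norm_cast))).1 hcrit
    rwa [hrange, fderivWithin_univ] at h1
  have hD2 : ∀ v, fderiv ℝ (fderiv ℝ uh) c v v = ‖A v‖ ^ 2 := by
    intro v
    rw [← real_inner_self_eq_norm_sq, ← hAval,
      ← g.hessian_eq_fderiv_fderiv_of_fderiv_eq_zero (hu y₀) hcrit' v v, hHess]
  set ε₁ : ℝ := η / (2 * (nT ^ 2 + 1)) with hε₁
  have hε₁0 : 0 < ε₁ := by positivity
  have hε₁le : ε₁ * nT ^ 2 ≤ η / 2 := by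
    rw [hε₁, div_mul_eq_mul_div, div_le_iff₀ (by positivity)]
    nlinarith [sq_nonneg nT]
  obtain ⟨δ₁, hδ₁, htaylor⟩ := abs_sub_sub_half_fderiv_fderiv_le huh2 hcrit' hε₁0
  have huc : uh c = 0 := by rw [huh_apply, hpc, hu0]
  -- `uh (c + x) ≤ (1 + η)/2 ‖A x‖²` for small `x`
  have hupper : ∀ x, ‖x‖ < δ₁ → uh (c + x) ≤ (1 + η) / 2 * ‖A x‖ ^ 2 := by
    intro x hx
    have h1 := htaylor x hx
    rw [huc, sub_zero, hD2] at h1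
    have h2 := (abs_le.1 h1).2
    have h3 : ε₁ * ‖x‖ ^ 2 ≤ η / 2 * ‖A x‖ ^ 2 := by
      have hxx : ‖x‖ ^ 2 ≤ nT ^ 2 * ‖A x‖ ^ 2 := by
        have := hxA x
        have h' : 0 ≤ nT * ‖A x‖ := mul_nonneg hnT0 (norm_nonneg _)
        nlinarith [norm_nonneg x]
      calc ε₁ * ‖x‖ ^ 2 ≤ ε₁ * (nT ^ 2 * ‖A x‖ ^ 2) := mul_le_mul_of_nonneg_left hxx hε₁0.le
        _ = (ε₁ * nT ^ 2) * ‖A x‖ ^ 2 := by ring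
        _ ≤ (η / 2) * ‖A x‖ ^ 2 := mul_le_mul_of_nonneg_right hε₁le (sq_nonneg _)
    nlinarith
  -- ### (5) the radius `s₀`
  set δ₀ : ℝ := min δ₁ δ₂ with hδ₀
  have hδ₀pos : 0 < δ₀ := lt_min hδ₁ hδ₂
  set s₀ : ℝ := δ₀ ^ 2 / (2 * (nT + 1) ^ 2) with hs₀
  have hs₀pos : 0 < s₀ := by positivity
  refine ⟨s₀, hs₀pos, fun s hs hss₀ ↦ ?_⟩
  -- the ellipsoid `T = {‖A x‖ < t}`, `t = √(2 s (1 − η))`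
  set t : ℝ := Real.sqrt (2 * s * (1 - η)) with ht
  have ht0 : 0 < t := Real.sqrt_pos.2 (by nlinarith)
  have htsq : t ^ 2 = 2 * s * (1 - η) := Real.sq_sqrt (by nlinarith)
  set T : Set (EuclideanSpace ℝ (Fin m)) :=
    (A : EuclideanSpace ℝ (Fin m) → EuclideanSpace ℝ (Fin m)) ⁻¹' ball 0 t with hT
  set Bs : Set (EuclideanSpace ℝ (Fin m)) := (fun x ↦ c + x) '' T with hBs
  -- points of `T` are `δ₀`-small
  have hTsmall : ∀ x ∈ T, ‖x‖ < δ₀ := by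
    intro x hx
    have hAx : ‖A x‖ < t := by simpa [hT] using hx
    have h1 : ‖x‖ ≤ nT * t := (hxA x).trans (mul_le_mul_of_nonneg_left hAx.le hnT0)
    have h2 : (nT * t) ^ 2 < δ₀ ^ 2 := by
      have : t ^ 2 ≤ 2 * s := by rw [htsq]; nlinarith
      have hs' : 2 * s < δ₀ ^ 2 / (nT + 1) ^ 2 := by
        rw [hs₀] at hss₀
        rw [lt_div_iff₀ (by positivity)] at hss₀ ⊢
        nlinarith
      calc (nT * t) ^ 2 = nT ^ 2 * t ^ 2 := by ring
        _ ≤ nT ^ 2 * (2 * s) := mul_le_mul_of_nonneg_left this (sq_nonneg _)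
        _ ≤ (nT + 1) ^ 2 * (2 * s) := by
            apply mul_le_mul_of_nonneg_right _ (by linarith); nlinarith
        _ < (nT + 1) ^ 2 * (δ₀ ^ 2 / (nT + 1) ^ 2) := mul_lt_mul_of_pos_left hs' (by positivity)
        _ = δ₀ ^ 2 := by field_simp
    have h3 : 0 ≤ nT * t := mul_nonneg hnT0 ht0.le
    nlinarith [norm_nonneg x]
  have hBsδ : Bs ⊆ ball c δ₂ := by
    rintro _ ⟨x, hx, rfl⟩
    rw [Metric.mem_ball, dist_eq_norm, add_sub_cancel_left]
    exact (hTsmall x hx).trans_le (min_le_right _ _)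
  have hBst : Bs ⊆ φ.target := hBsδ.trans hδ₂t
  -- ### (6) the chart image of `Bs` lies in `{u < s}`
  set S : Set N := φ ⁻¹' Bs ∩ φ.source with hS
  have hSsub : S ⊆ {y | u y < s} := by
    rintro y ⟨hyB, hys⟩
    obtain ⟨x, hxT, hxy⟩ := hyB
    have hAx : ‖A x‖ < t := by simpa [hT] using hxT
    have hx1 : ‖x‖ < δ₁ := (hTsmall x hxT).trans_le (min_le_left _ _)
    have h1 := hupper x hx1
    have hxy' : c + x = φ y := hxy
    rw [hxy', huh_apply, φ.left_inv hys] at h1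
    show u y < s
    have h2 : ‖A x‖ ^ 2 < t ^ 2 := by
      have := norm_nonneg (A x); nlinarith
    rw [htsq] at h2
    have h3 : (1 + η) / 2 * ‖A x‖ ^ 2 < (1 + η) / 2 * (2 * s * (1 - η)) :=
      mul_lt_mul_of_pos_left h2 (by positivity)
    have h4 : (1 + η) / 2 * (2 * s * (1 - η)) = s * (1 - η ^ 2) := by ring
    have h5 : s * (1 - η ^ 2) ≤ s := by nlinarith [sq_nonneg η]
    linarith
  -- ### (7) the measure of `S` in the chart
  have hTo : IsOpen T := isOpen_ball.preimage A.continuous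
  have hBo : IsOpen Bs := isOpenMap_add_left c T hTo
  have hBm : MeasurableSet Bs := hBo.measurableSet
  have hsrc : MeasurableSet φ.source := (isOpen_extChartAt_source y₀).measurableSet
  have hμS : μ S = ∫⁻ e in Bs, ENNReal.ofReal (ρ e) := by
    have h1 : μ S = (μ.restrict φ.source) (φ ⁻¹' Bs) := by
      rw [Measure.restrict_apply' hsrc]
    have h2 : (μ.restrict φ.source) (φ ⁻¹' Bs) = ((μ.restrict φ.source).map φ) Bs :=
      (Measure.map_apply_of_aemeasurable (aemeasurable_extChartAt_restrict y₀ μ) hBm).symm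
    have hBst' : Bs ∩ (extChartAt (𝓡 m) y₀).target = Bs := inter_eq_left.2 hBst
    have h3 : ((μ.restrict φ.source).map φ) Bs = ∫⁻ e in Bs, ENNReal.ofReal (ρ e) := by
      rw [hμ, hφ, map_extChartAt_restrict_riemannianMeasure h y₀, withDensity_apply _ hBm,
        Measure.restrict_restrict hBm, hBst']
    rw [h1, h2, h3]
  have hvolB : volume Bs = ENNReal.ofReal (|dA|⁻¹ * t ^ m) *
      volume (ball (0 : EuclideanSpace ℝ (Fin m)) 1) := by
    rw [hBs, volume_image_const_add, hT, volume_preimage_ball_eq A ht0]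
  have hlow : ENNReal.ofReal ((1 - η) * |dA|) * volume Bs ≤ μ S := by
    rw [hμS, ← setLIntegral_const]
    exact setLIntegral_mono' hBm fun e he ↦ ENNReal.ofReal_le_ofReal (hρge e (hBsδ he))
  -- ### (8) conclusion
  have hkey : ENNReal.ofReal ((1 - η) * |dA|) * volume Bs =
      ENNReal.ofReal ((1 - η) * t ^ m) * volume (ball (0 : EuclideanSpace ℝ (Fin m)) 1) := by
    rw [hvolB, ← mul_assoc, ← ENNReal.ofReal_mul (by nlinarith)]
    congr 2
    field_simp
  have hcomp : (1 - ε) * Real.sqrt (2 * s) ^ m ≤ (1 - η) * t ^ m := by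
    have hsq : Real.sqrt (2 * s * (1 - η)) = Real.sqrt (2 * s) * Real.sqrt (1 - η) :=
      Real.sqrt_mul' _ (by linarith)
    have h1 : 1 - η ≤ Real.sqrt (1 - η) := by
      have h0 : 0 ≤ 1 - η := by linarith
      calc 1 - η = Real.sqrt ((1 - η) ^ 2) := (Real.sqrt_sq h0).symm
        _ ≤ Real.sqrt (1 - η) := Real.sqrt_le_sqrt (by nlinarith)
    have h2 : (1 - η) ^ m ≤ Real.sqrt (1 - η) ^ m :=
      pow_le_pow_left₀ (by linarith) h1 m
    have h3 : 0 ≤ Real.sqrt (2 * s) ^ m := pow_nonneg (Real.sqrt_nonneg _) m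
    calc (1 - ε) * Real.sqrt (2 * s) ^ m ≤ (1 - η) ^ (m + 1) * Real.sqrt (2 * s) ^ m :=
          mul_le_mul_of_nonneg_right hBern h3
      _ = (1 - η) * ((1 - η) ^ m * Real.sqrt (2 * s) ^ m) := by ring
      _ ≤ (1 - η) * (Real.sqrt (1 - η) ^ m * Real.sqrt (2 * s) ^ m) :=
          mul_le_mul_of_nonneg_left (mul_le_mul_of_nonneg_right h2 h3) (by linarith)
      _ = (1 - η) * t ^ m := by rw [ht, hsq, mul_pow]; ring
  calc ENNReal.ofReal ((1 - ε) * Real.sqrt (2 * s) ^ m) *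
        volume (ball (0 : EuclideanSpace ℝ (Fin m)) 1)
      ≤ ENNReal.ofReal ((1 - η) * t ^ m) * volume (ball (0 : EuclideanSpace ℝ (Fin m)) 1) :=
        mul_le_mul_left (ENNReal.ofReal_le_ofReal hcomp) _
    _ = ENNReal.ofReal ((1 - η) * |dA|) * volume Bs := hkey.symm
    _ ≤ μ S := hlow
    _ ≤ μ {y | u y < s} := measure_mono hSsub

end Main

end Literature.Geometry.Riemannian

end
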